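import Literature.IUT.HodgeTheaters.TemperedCoverings
import HarnessLib

/-!
# [IUTchI] Corollary 2.3 (vi) AS TYPED, reduced to the graph-level cusp–subgraph incidence

Mochizuki, *Inter-universal Teichmüller theory I*, kurims manuscript (May 2020), §2, Corollary 2.3 (vi)
p. 48, proof p. 49 l. −12 («Assertion (vi) follows immediately from a similar argument to the argument
applied in the proof of [CombGC], Proposition 1.5, (i), by passing to pro-Σ completions»)
([IUTchI] Cor 2.3(vi) pp.48-49) [claim: Mochizuki2012, status: disputed].
Proof-only companion of `TemperedCoverings.lean` (seat abc-iut-L5-t1; node IUTchI:Cor2.3(vi)), in the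
pattern of `TemperedCoveringsSubgraphClosures.lean` (Cor. 2.3 (ii), (v)): the typed predicate
`StableCurveTemperedData.Cor23vi` —

  for a cusp `x` with inertia group `I_x ⊆ Δ^tp_X` (resp. its image in `Δ̂_X`): `I_x` lies in a
  `Δ^tp_X`- (resp. `Δ̂_X`-) conjugate of `Δ^tp_{X,ℍ} = Δ^tp_X ×_{Π^tp_𝔾} Π^tp_ℍ` (resp. of
  `Δ̂_{X,ℍ} = Δ̂_X ×_{Π̂_𝔾} Π̂_ℍ`) iff the cusp `ξ` of the stable model corresponding to `x` meets an
  irreducible component of the special fibre contained in `ℍ` —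

is, by the surjectivity of `Δ^tp_X ↠ Π^tp_𝔾`, `Δ̂_X ↠ Π̂_𝔾` and the compatibility
`ρ̂ ∘ ι_Δ = ι ∘ ρ^tp` of the interface data ALONE, EQUIVALENT (`cor23vi_iff_graph`) to the pair of
𝔾-LEVEL incidence statements about the cuspidal subgroup `J_x := ρ^tp(I_x) ⊆ Π^tp_𝔾` of the dual
semi-graph:

* (tempered)  `J_x` lies in a `Π^tp_𝔾`-conjugate of `Π^tp_ℍ` iff `ξ` meets `ℍ`;
* (profinite) `ι(J_x)` lies in a `Π̂_𝔾`-conjugate of `Π̂_ℍ` iff `ξ` meets `ℍ`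

— which are exactly the cusp/vertex incidence relations of [CombGC] Prop. 1.5 (i) type for the
semi-graph of anabelioids `𝔾 ⊇ ℍ` and its pro-`Σ̂` completion that the printed proof invokes (L3 merge
debt: [SemiAnbd] §3 / [CombGC] §1 over abc-iut-L3's `PSCDatum` / tempered-π₁ interface; consumed here as
hypotheses stated inline, never asserted).  Since «tempered conjugate ⇒ profinite conjugate» is formal
(`Π^tp_ℍ ↪ Π̂_ℍ`), the typed node already follows from ONE direction of each (`cor23vi_of_graph`):
(b ⇒ a) at the tempered level and (a ⇒ b) at the profinite level.
No new definitions; the typed predicate is untouched; nothing here takes a side on [IUTchIII] Cor. 3.12;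
typed ≠ discharged for the 𝔾-level inputs.
-/

namespace Literature.IUT.HodgeTheaters

open Pointwise

universe u

/-! ### Two pointwise-conjugation lemmas for subgroups along a homomorphism -/

/-- Conjugating a pulled-back subgroup: `d · f⁻¹(T) · d⁻¹ = f⁻¹(f(d) · T · f(d)⁻¹)`.
([IUTchI] Cor 2.3(vi) p.48) [claim: Mochizuki2012, status: disputed] -/
theorem conj_smul_comap_eq {G G' : Type*} [Group G] [Group G'] (f : G →* G') (T : Subgroup G')
    (d : G) : MulAut.conj d • T.comap f = (MulAut.conj (f d) • T).comap f := by
  ext x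
  simp only [Subgroup.mem_pointwise_smul_iff_inv_smul_mem, Subgroup.mem_comap, MulAut.smul_def,
    MulAut.conj_inv_apply, map_mul, map_inv]

/-- Pushing a conjugate forward: `f(d · S · d⁻¹) = f(d) · f(S) · f(d)⁻¹`.
([IUTchI] Cor 2.3(vi) p.48) [claim: Mochizuki2012, status: disputed] -/
theorem map_conj_smul_eq {G G' : Type*} [Group G] [Group G'] (f : G →* G') (S : Subgroup G)
    (d : G) : (MulAut.conj d • S).map f = MulAut.conj (f d) • S.map f := by
  ext y
  constructor
  · rintro ⟨x, hx, rfl⟩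
    obtain ⟨s, hs, rfl⟩ := Subgroup.mem_smul_pointwise_iff_exists x _ _ |>.mp hx
    refine (Subgroup.mem_smul_pointwise_iff_exists _ _ _).mpr ⟨f s, ⟨s, hs, rfl⟩, ?_⟩
    simp only [MulAut.smul_def, MulAut.conj_apply, map_mul, map_inv]
  · intro hy
    obtain ⟨z, ⟨s, hs, rfl⟩, rfl⟩ := (Subgroup.mem_smul_pointwise_iff_exists y _ _).mp hy
    refine ⟨MulAut.conj d • s, Subgroup.smul_mem_pointwise_smul _ _ _ hs, ?_⟩
    simp only [MulAut.smul_def, MulAut.conj_apply, map_mul, map_inv]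

namespace StableCurveTemperedData

variable (D : StableCurveTemperedData.{u})

/-- Compatibility of the interface as an identity of homomorphisms: `ρ̂ ∘ ι_Δ = ι ∘ ρ^tp`
(«compatibility `Π^tp_𝔾 ↪ Π̂_𝔾` versus `Δ^tp_X ↪ Δ̂_X`», p. 47).
([IUTchI] Cor 2.3 p.47) [claim: Mochizuki2012, status: disputed] -/
theorem ρHat_comp_ιΔ : D.ρHat.comp D.ιΔ = D.graph.ι.comp D.ρTp :=
  MonoidHom.ext fun d => (D.ρ_comp d).symm

/-- The image in `Π̂_𝔾` of the profinite inertia group `ι_Δ(I_x) ⊆ Δ̂_X` is `ι(J_x)`.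
([IUTchI] Cor 2.3(vi) p.48) [claim: Mochizuki2012, status: disputed] -/
theorem map_ρHat_map_ιΔ_inertia (x : D.Cusp) :
    ((D.inertiaTp x).map D.ιΔ).map D.ρHat = ((D.inertiaTp x).map D.ρTp).map D.graph.ι := by
  rw [Subgroup.map_map, ρHat_comp_ιΔ, ← Subgroup.map_map]

/-- TEMPERED TRANSFER.  `I_x` lies in a `Δ^tp_X`-conjugate of `Δ^tp_{X,ℍ} = (ρ^tp)⁻¹(Π^tp_ℍ)` iff
`J_x = ρ^tp(I_x)` lies in a `Π^tp_𝔾`-conjugate of `Π^tp_ℍ` (surjectivity of `Δ^tp_X ↠ Π^tp_𝔾`).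
([IUTchI] Cor 2.3(vi) p.48) [claim: Mochizuki2012, status: disputed] -/
theorem inertia_le_conj_deltaTpH_iff (x : D.Cusp) :
    (∃ d : D.DeltaTp, D.inertiaTp x ≤ MulAut.conj d • D.deltaTpH) ↔
      ∃ t : D.graph.Tp, (D.inertiaTp x).map D.ρTp ≤ MulAut.conj t • D.graph.TpH := by
  constructor
  · rintro ⟨d, hd⟩
    refine ⟨D.ρTp d, ?_⟩
    rw [deltaTpH, conj_smul_comap_eq] at hd
    exact Subgroup.map_le_iff_le_comap.mpr hd
  · rintro ⟨t, ht⟩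
    obtain ⟨d, rfl⟩ := D.ρTp_surjective t
    refine ⟨d, ?_⟩
    rw [deltaTpH, conj_smul_comap_eq]
    exact Subgroup.map_le_iff_le_comap.mp ht

/-- PROFINITE TRANSFER.  `ι_Δ(I_x)` lies in a `Δ̂_X`-conjugate of `Δ̂_{X,ℍ} = ρ̂⁻¹(Π̂_ℍ)` iff
`ι(J_x)` lies in a `Π̂_𝔾`-conjugate of `Π̂_ℍ` (surjectivity of `Δ̂_X ↠ Π̂_𝔾` and `ρ̂ ∘ ι_Δ = ι ∘ ρ^tp`).
([IUTchI] Cor 2.3(vi) p.48) [claim: Mochizuki2012, status: disputed] -/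
theorem inertia_le_conj_deltaHatH_iff (x : D.Cusp) :
    (∃ d : D.DeltaHat, (D.inertiaTp x).map D.ιΔ ≤ MulAut.conj d • D.deltaHatH) ↔
      ∃ g : D.graph.Hat, ((D.inertiaTp x).map D.ρTp).map D.graph.ι ≤ MulAut.conj g • D.graph.HatH := by
  constructor
  · rintro ⟨d, hd⟩
    refine ⟨D.ρHat d, ?_⟩
    rw [deltaHatH, conj_smul_comap_eq] at hd
    rw [← map_ρHat_map_ιΔ_inertia]
    exact Subgroup.map_le_iff_le_comap.mpr hd
  · rintro ⟨g, hg⟩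
    obtain ⟨d, rfl⟩ := D.ρHat_surjective g
    refine ⟨d, ?_⟩
    rw [deltaHatH, conj_smul_comap_eq]
    rw [← map_ρHat_map_ιΔ_inertia] at hg
    exact Subgroup.map_le_iff_le_comap.mp hg

/-- «Tempered conjugate ⇒ profinite conjugate» is formal: if `J_x ⊆ t · Π^tp_ℍ · t⁻¹` in `Π^tp_𝔾`, then
`ι(J_x) ⊆ ι(t) · Π̂_ℍ · ι(t)⁻¹` in `Π̂_𝔾`, because `ι(Π^tp_ℍ) ⊆ Π̂_ℍ` (the commutative diagram of p. 44).
([IUTchI] Cor 2.3(vi) p.48) [claim: Mochizuki2012, status: disputed] -/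
theorem cuspImage_hat_of_tp (x : D.Cusp)
    (h : ∃ t : D.graph.Tp, (D.inertiaTp x).map D.ρTp ≤ MulAut.conj t • D.graph.TpH) :
    ∃ g : D.graph.Hat, ((D.inertiaTp x).map D.ρTp).map D.graph.ι ≤ MulAut.conj g • D.graph.HatH := by
  obtain ⟨t, ht⟩ := h
  refine ⟨D.graph.ι t, ?_⟩
  calc ((D.inertiaTp x).map D.ρTp).map D.graph.ι
      ≤ (MulAut.conj t • D.graph.TpH).map D.graph.ι := Subgroup.map_mono ht
    _ = MulAut.conj (D.graph.ι t) • D.graph.TpH.map D.graph.ι := map_conj_smul_eq _ _ _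
    _ ≤ MulAut.conj (D.graph.ι t) • D.graph.HatH :=
        Subgroup.pointwise_smul_le_pointwise_smul_iff.mpr D.graph.tpH_le

/-- **Corollary 2.3 (vi) ⟺ the 𝔾-level incidence relations.**  The typed `Cor23vi` holds for `D` iff,
for every cusp `x` [with `ξ` the corresponding cusp of the stable model and `J_x = ρ^tp(I_x) ⊆ Π^tp_𝔾`]:
(tempered) `J_x` lies in a `Π^tp_𝔾`-conjugate of `Π^tp_ℍ` iff `ξ` meets an irreducible component of the
special fibre contained in `ℍ`, and (profinite) `ι(J_x)` lies in a `Π̂_𝔾`-conjugate of `Π̂_ℍ` iff `ξ`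
meets such a component — the [CombGC] Prop. 1.5 (i)-type incidence for `𝔾` and for its pro-`Σ̂`
completion invoked on p. 49.  FQ type per the gate rule.
([IUTchI] Cor 2.3(vi) pp.48-49) [claim: Mochizuki2012, status: disputed] -/
theorem cor23vi_iff_graph :
    Literature.IUT.HodgeTheaters.StableCurveTemperedData.Cor23vi D ↔
      (∀ x : D.Cusp, (∃ t : D.graph.Tp, (D.inertiaTp x).map D.ρTp ≤ MulAut.conj t • D.graph.TpH) ↔
          D.cuspMeetsH x) ∧
      (∀ x : D.Cusp, (∃ g : D.graph.Hat, ((D.inertiaTp x).map D.ρTp).map D.graph.ι ≤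
          MulAut.conj g • D.graph.HatH) ↔ D.cuspMeetsH x) := by
  rw [cor23vi_iff]
  refine and_congr (forall_congr' fun x => ?_) (forall_congr' fun x => ?_)
  · rw [inertia_le_conj_deltaTpH_iff]
  · rw [inertia_le_conj_deltaHatH_iff]

/-- **Corollary 2.3 (vi) from ONE direction at each level.**  If (tempered, b ⇒ a) whenever `ξ` meets
an irreducible component contained in `ℍ` the cuspidal subgroup `J_x` lies in a `Π^tp_𝔾`-conjugate of
`Π^tp_ℍ`, and (profinite, a ⇒ b) whenever `ι(J_x)` lies in a `Π̂_𝔾`-conjugate of `Π̂_ℍ` the cusp `ξ`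
meets such a component, then the typed `Cor23vi` holds for `D`: the remaining two directions are the
formal «tempered conjugate ⇒ profinite conjugate» (`cuspImage_hat_of_tp`).  FQ type per the gate rule.
([IUTchI] Cor 2.3(vi) pp.48-49) [claim: Mochizuki2012, status: disputed] -/
theorem cor23vi_of_graph
    (htp : ∀ x : D.Cusp, D.cuspMeetsH x →
      ∃ t : D.graph.Tp, (D.inertiaTp x).map D.ρTp ≤ MulAut.conj t • D.graph.TpH)
    (hhat : ∀ x : D.Cusp, (∃ g : D.graph.Hat, ((D.inertiaTp x).map D.ρTp).map D.graph.ι ≤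
      MulAut.conj g • D.graph.HatH) → D.cuspMeetsH x) :
    Literature.IUT.HodgeTheaters.StableCurveTemperedData.Cor23vi D :=
  (cor23vi_iff_graph D).mpr
    ⟨fun x => ⟨fun h => hhat x (D.cuspImage_hat_of_tp x h), htp x⟩,
     fun x => ⟨hhat x, fun h => D.cuspImage_hat_of_tp x (htp x h)⟩⟩

/-- Conversely, the typed `Cor23vi` yields both 𝔾-level incidence relations (so the reduction loses
nothing). ([IUTchI] Cor 2.3(vi) pp.48-49) [claim: Mochizuki2012, status: disputed] -/
theorem graph_incidence_of_cor23vi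
    (h : Literature.IUT.HodgeTheaters.StableCurveTemperedData.Cor23vi D) (x : D.Cusp) :
    ((∃ t : D.graph.Tp, (D.inertiaTp x).map D.ρTp ≤ MulAut.conj t • D.graph.TpH) ↔ D.cuspMeetsH x) ∧
      ((∃ g : D.graph.Hat, ((D.inertiaTp x).map D.ρTp).map D.graph.ι ≤ MulAut.conj g • D.graph.HatH) ↔
        D.cuspMeetsH x) :=
  ⟨((cor23vi_iff_graph D).mp h).1 x, ((cor23vi_iff_graph D).mp h).2 x⟩

end StableCurveTemperedData

end Literature.IUT.HodgeTheaters
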